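import Summits.ResolutionOfSingularities.ResolutionOfSingularities.Theorems.EquisingularLiftEquisingularLiftNatSpecimenSteinerStrictChart0
import Summits.ResolutionOfSingularities.ResolutionOfSingularities.Theorems.EquisingularLiftEquisingularLiftNatRedSubAffineChart
import HarnessLib

/-!
# [OURS · L1 W4.5(b) · EL♮(3) · NOSE, N-2 (d) packet 0, Part C] STEINER — THE CHART-ATLAS PACKET OF THE VERTEX CHART `y₀ ≠ 0`: chart of `St~`, centre `(u, v)~`,
# and the two blow-up-algebra regularities (✓ `Steiner.isRegularRing_chart₁/₂`, no transport)

res-L1-w45b-nose-w2 g2 (WIDTH seat on D-0157 DOOR 1; self-dealt under the desk's N-2 GO). OURS; NOT a statement of any manuscript ([Hironaka2017] is a candidate under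
adjudication, nothing of it is asserted); AI-written, weaker than expert review. No `sorry`; standard axioms; DEF-FREE (standing `local instance` attribute of the specimen files).
`--kind proof --supports stmt-ResolutionOfSingularities-20148 --as helper`; closes nothing. Resolution of singularities in positive characteristic is NOT proved here or anywhere in
this chain (dimension 3 is Cossart–Piltant 2008/2009 in print); EL♮(3) is NOT proved by this file.

WHAT. The FIRST of the six packets of clause (d) of «Steiner ∈ ν2» for the frame ✓ `isRegular_of_isBlowup_of_chartAtlas` (…NatBlowupRegularOfChartAtlas) with base
`H := St~ = redSub F₂ St` (the reduced strict transform of the Roman surface in `F₂ = Bl_P ℙ³`) and centre `J := 𝓘⟨Z′⟩·𝒪_{St~}`, `Z′ = ⋃ᵢ vertexLineStrict υ i`: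
* §1 `comap_vertexChart_zero_vanishingIdeal_noseSet` — on the vertex chart `Spec C₀`, `𝓘⟨Z′⟩·𝒪 = (y₁/y₀, y₂/y₀)~` (nose-w3 ✓ `preimage_vertexChart_vertexLineStrict(_of_ne)`,
  ✓ `isPrime_span_frac`);
* §2 the POLYNOMIAL vertex chart `Spec(θ⁻¹) ≫ vertexChart υ 0 : Spec k[y₀,u,v] ⟶ F₂` pulls `𝓘⟨St⟩` to `(f₁)~` and `𝓘⟨Z′⟩` to `(u,v)~` (`comap_polyChart_zero`) — so the packet
  lives over `A₀ := k[y]/(f₁)`, the ring of ✓ p649392, and no transport of the blow-up algebras is needed;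
* §3 ★ `packet_chart0` — the packet: an open immersion `c₀' : Spec (k[y]/(f₁)) ⟶ St~` over the polynomial vertex chart covering `St~` over the range of `vertexChart υ 0`
  (Part B `exists_openImmersion_specQuotient` fed with Part A `comap_vertexChart_zero_vanishingIdeal_strict`), with `J.comap c₀' = ((ȳ₁, ȳ₂))~` and the two
  blow-up algebras at `ȳ₁`, `ȳ₂` regular rings (✓ `Steiner.isRegularRing_chart₁/₂` verbatim).
Remaining for (d): packets i = 1, 2 (renamed twins of this file + `subst_point_f`/`isRegularRing_chart` twins for charts y₁, y₂), the three far packets (υ iso off P;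
`ChartRing form c`, ✓ `isRegularRing_chartFar₁/₂` + twins), `hcov`, then `LinearCentre.isRegular_reducedStrictTransform_of_blowupModel`.
-/

set_option linter.dupNamespace false -- mandated namespace `Summit.<Summit>.<Problem>` of this single-conjunct summit

noncomputable section

open CategoryTheory CategoryTheory.Limits AlgebraicGeometry TopologicalSpace HomogeneousLocalization
open MvPolynomial
open Literature.AlgebraicGeometry.Resolution Literature.AlgebraicGeometry.Resolution.DeJong1996
open Literature.AlgebraicGeometry.Motives Literature.AlgebraicGeometry.Motives.SmoothHypersurface
open Literature.AlgebraicGeometry.Motives.ProjectiveSpace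
open AlgebraicGeometry.Scheme.IdealSheafData
open Summit.ResolutionOfSingularities.ResolutionOfSingularities.Theorems.EquisingularLift

attribute [local instance] MvPolynomial.gradedAlgebra ProjBaseChange.algebraBase

namespace Summit.ResolutionOfSingularities.ResolutionOfSingularities.Cruxes.EquisingularLiftNat.Sections

namespace Steiner

variable (k : Type) [Field k]

/-! ## §1 The centre `𝓘⟨Z′⟩` on the vertex chart `Spec C₀` -/

section Centre

variable {k} {F₂ : Scheme.{0}} {υ : F₂ ⟶ SpecimenQuarticTcDelta.P3 k} (hυ : IsBlowup υ (vertexIdealSheaf 2 k))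

include hυ in
/-- The nose set meets the vertex chart `Spec C₀` in `V(y₁/y₀, y₂/y₀)` (only the strict transform of the line `i = 0` is visible there). [folklore] -/
theorem preimage_vertexChart_zero_noseSet :
    (vertexChart hυ 0) ⁻¹' (⋃ i : Fin 3, vertexLineStrict υ i) =
      PrimeSpectrum.zeroLocus (Ideal.span (PointBlowup.frac 2 k 0 '' {(0 : Fin 3)}ᶜ) : Set (PointBlowup.Chart 2 k 0)) := by
  rw [Set.preimage_iUnion]
  ext 𝔭
  simp only [Set.mem_iUnion]
  constructor
  · rintro ⟨i, hi⟩
    by_cases h0 : i = 0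
    · subst h0; rwa [preimage_vertexChart_vertexLineStrict hυ 0] at hi
    · rw [preimage_vertexChart_vertexLineStrict_of_ne hυ i (Ne.symm h0)] at hi; exact absurd hi (Set.notMem_empty _)
  · intro h
    exact ⟨0, by rwa [preimage_vertexChart_vertexLineStrict hυ 0]⟩

include hυ in
/-- **`𝓘⟨Z′⟩·𝒪_{Spec C₀} = (y₁/y₀, y₂/y₀)~`** (the ideal is prime, ✓ `isPrime_span_frac`). [folklore] -/
theorem comap_vertexChart_zero_vanishingIdeal_noseSet :
    (vanishingIdeal (⟨⋃ i : Fin 3, vertexLineStrict υ i, isClosed_iUnion_vertexLineStrict υ⟩ : Closeds F₂)).comap (vertexChart hυ 0) =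
      affineBlowup.idealSheaf (Ideal.span (PointBlowup.frac 2 k 0 '' {(0 : Fin 3)}ᶜ)) := by
  rw [comap_vanishingIdeal_of_isOpenImmersion]
  have h : (Closeds.preimage (⟨⋃ i : Fin 3, vertexLineStrict υ i, isClosed_iUnion_vertexLineStrict υ⟩ : Closeds F₂) (vertexChart hυ 0).continuous) =
      ⟨PrimeSpectrum.zeroLocus (Ideal.span (PointBlowup.frac 2 k 0 '' {(0 : Fin 3)}ᶜ) : Set (PointBlowup.Chart 2 k 0)), PrimeSpectrum.isClosed_zeroLocus _⟩ :=
    Closeds.ext (preimage_vertexChart_zero_noseSet hυ)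
  rw [h]
  refine (SpecimenQuarticTcDelta.vanishingIdeal_zeroLocus_Spec (CommRingCat.of (PointBlowup.Chart 2 k 0)) _).trans ?_
  rw [Ideal.span_eq, (isPrime_span_frac (0 : Fin 3)).radical]
  rfl

end Centre

/-! ## §2 The polynomial model of the vertex chart: `Spec k[y] ≅ Spec C₀ ⟶ F₂` -/

section Packet

variable {k} {F₂ : Scheme.{0}} {υ : F₂ ⟶ SpecimenQuarticTcDelta.P3 k} (hυ : IsBlowup υ (vertexIdealSheaf 2 k))

/-- `θ⁻¹` carries `(θ f₁)` back to `(f₁)`. [folklore] -/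
theorem map_symm_span_algEquiv_f₁ (θ : MvPolynomial (Fin 3) k ≃ₐ[k] PointBlowup.Chart 2 k 0) :
    (Ideal.span {θ (f₁ k)}).map (θ.symm.toRingEquiv : PointBlowup.Chart 2 k 0 →+* MvPolynomial (Fin 3) k) = Ideal.span {f₁ k} := by
  rw [Ideal.map_span, Set.image_singleton]
  exact congrArg (fun x => Ideal.span {x}) (θ.symm_apply_apply (f₁ k))

/-- `θ⁻¹` carries the ratios `{y₁/y₀, y₂/y₀}` to the centre variables `{y₁, y₂}` of ✓ p649392's chart rings. [folklore] -/
theorem map_symm_span_frac (θ : MvPolynomial (Fin 3) k ≃ₐ[k] PointBlowup.Chart 2 k 0)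
    (hθj : ∀ j : Fin 3, j ≠ 0 → θ (X j) = PointBlowup.frac 2 k 0 j) :
    (Ideal.span (PointBlowup.frac 2 k 0 '' {(0 : Fin 3)}ᶜ)).map (θ.symm.toRingEquiv : PointBlowup.Chart 2 k 0 →+* MvPolynomial (Fin 3) k) =
      Ideal.span (X '' CuspCone.cenVars) := by
  have hcen : (CuspCone.cenVars : Set (Fin 3)) = {(0 : Fin 3)}ᶜ := by
    ext j; fin_cases j <;> simp [CuspCone.cenVars]
  rw [Ideal.map_span, Set.image_image, hcen]
  refine congrArg Ideal.span (Set.image_congr fun j hj => ?_)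
  have h := congrArg θ.symm (hθj j (Set.mem_compl_singleton_iff.mp hj))
  rw [AlgEquiv.symm_apply_apply] at h
  simpa using h.symm

include hυ in
/-- **The polynomial vertex chart** `c₀ := Spec(θ⁻¹) ≫ vertexChart υ 0 : Spec k[y₀, u, v] ⟶ F₂` pulls `𝓘⟨St⟩` back to `(f₁)~` and `𝓘⟨Z′⟩` to `(u, v)~ = (y₁, y₂)~` — the
currency of ✓ `Steiner.isRegularRing_chart₁/₂`. [folklore] -/
theorem comap_polyChart_zero (θ : MvPolynomial (Fin 3) k ≃ₐ[k] PointBlowup.Chart 2 k 0)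
    (hθi : θ (X 0) = PointBlowup.exc 2 k 0) (hθj : ∀ j : Fin 3, j ≠ 0 → θ (X j) = PointBlowup.frac 2 k 0 j) :
    (vanishingIdeal (⟨closure (υ ⁻¹' (Set.range (hypersurfaceι (form k)).left \ {vertex 2 k})), isClosed_closure⟩ : Closeds F₂)).comap
        (Spec.map (CommRingCat.ofHom (θ.symm.toRingEquiv : PointBlowup.Chart 2 k 0 →+* MvPolynomial (Fin 3) k)) ≫ vertexChart hυ 0) =
      affineBlowup.idealSheaf (Ideal.span {f₁ k}) ∧
    (vanishingIdeal (⟨⋃ i : Fin 3, vertexLineStrict υ i, isClosed_iUnion_vertexLineStrict υ⟩ : Closeds F₂)).comap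
        (Spec.map (CommRingCat.ofHom (θ.symm.toRingEquiv : PointBlowup.Chart 2 k 0 →+* MvPolynomial (Fin 3) k)) ≫ vertexChart hυ 0) =
      affineBlowup.idealSheaf (Ideal.span (X '' CuspCone.cenVars)) := by
  constructor
  · rw [Scheme.IdealSheafData.comap_comp, comap_vertexChart_zero_vanishingIdeal_strict hυ θ hθi hθj]
    change (affineBlowup.idealSheaf (Ideal.span {θ (f₁ k)})).comap _ = _
    rw [affineBlowup.comap_idealSheaf_specMap, map_symm_span_algEquiv_f₁]
  · rw [Scheme.IdealSheafData.comap_comp, comap_vertexChart_zero_vanishingIdeal_noseSet hυ, affineBlowup.comap_idealSheaf_specMap,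
      map_symm_span_frac θ hθj]

/-- The generator family of the centre on the chart ring `k[y]/(f₁)`: `ȳ₁, ȳ₂`. [folklore] -/
theorem span_range_mk_X_cenVars :
    Ideal.span (Set.range fun j : ↥({(0 : Fin 3)}ᶜ : Set (Fin 3)) => Ideal.Quotient.mk (Ideal.span {f₁ k}) (X j.1 : MvPolynomial (Fin 3) k)) =
      (Ideal.span (X '' CuspCone.cenVars)).map (Ideal.Quotient.mk (Ideal.span {f₁ k})) := by
  have hcen : (CuspCone.cenVars : Set (Fin 3)) = {(0 : Fin 3)}ᶜ := by
    ext j; fin_cases j <;> simp [CuspCone.cenVars]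
  rw [Ideal.map_span, Set.image_image, hcen]
  congr 1
  ext x
  simp only [Set.mem_range, Set.mem_image, Subtype.exists, Set.mem_compl_iff, Set.mem_singleton_iff, exists_prop]

/-! ## §3 The packet -/

include hυ in
/-- ★ **PACKET 0 of clause (d)**, in the currency of ✓ p649392: for any chart isomorphism `θ` of `C₀` (✓ `Cone.exists_algEquiv_pointChart k 0`): an OPEN IMMERSION
`c₀' : Spec (k[y]/(f₁)) ⟶ St~` over the polynomial vertex chart `Spec(θ⁻¹) ≫ vertexChart υ 0` covering every point of `St~` over the range of `vertexChart υ 0`, on which the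
centre `𝓘⟨Z′⟩·𝒪_{St~}` is `((ȳ₁, ȳ₂))~`, with generators `ȳ₁, ȳ₂` whose blow-up algebras are REGULAR RINGS (✓ `Steiner.isRegularRing_chart₁/₂` verbatim).
[OURS · L1 W4.5b · (d) packet 0] -/
theorem packet_chart0 (θ : MvPolynomial (Fin 3) k ≃ₐ[k] PointBlowup.Chart 2 k 0)
    (hθi : θ (X 0) = PointBlowup.exc 2 k 0) (hθj : ∀ j : Fin 3, j ≠ 0 → θ (X j) = PointBlowup.frac 2 k 0 j) :
    ∃ (c' : Spec (CommRingCat.of (MvPolynomial (Fin 3) k ⧸ Ideal.span {f₁ k})) ⟶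
        redSub F₂ (closure (υ ⁻¹' (Set.range (hypersurfaceι (form k)).left \ {vertex 2 k}))) isClosed_closure) (_ : IsOpenImmersion c'),
      c' ≫ redSubι F₂ _ isClosed_closure = Spec.map (CommRingCat.ofHom (Ideal.Quotient.mk (Ideal.span {f₁ k}))) ≫
        (Spec.map (CommRingCat.ofHom (θ.symm.toRingEquiv : PointBlowup.Chart 2 k 0 →+* MvPolynomial (Fin 3) k)) ≫ vertexChart hυ 0) ∧
      (∀ z, (redSubι F₂ _ isClosed_closure z : F₂) ∈ Set.range (vertexChart hυ 0) → z ∈ Set.range c') ∧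
      ((vanishingIdeal (⟨⋃ i : Fin 3, vertexLineStrict υ i, isClosed_iUnion_vertexLineStrict υ⟩ : Closeds F₂)).comap
          (redSubι F₂ _ isClosed_closure)).comap c' =
        affineBlowup.idealSheaf (Ideal.span (Set.range fun j : ↥({(0 : Fin 3)}ᶜ : Set (Fin 3)) =>
          Ideal.Quotient.mk (Ideal.span {f₁ k}) (X j.1 : MvPolynomial (Fin 3) k))) ∧
      (∀ j : ↥({(0 : Fin 3)}ᶜ : Set (Fin 3)), IsRegularRing (blowupAlgebra
        (Ideal.span (Set.range fun j : ↥({(0 : Fin 3)}ᶜ : Set (Fin 3)) => Ideal.Quotient.mk (Ideal.span {f₁ k}) (X j.1 : MvPolynomial (Fin 3) k)))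
        (Ideal.Quotient.mk (Ideal.span {f₁ k}) (X j.1 : MvPolynomial (Fin 3) k)))) := by
  haveI : IsReduced (redSub F₂ (closure (υ ⁻¹' (Set.range (hypersurfaceι (form k)).left \ {vertex 2 k}))) isClosed_closure) :=
    ComponentGluing.isReduced_subscheme_vanishingIdeal _
  obtain ⟨hSt, hZ'⟩ := comap_polyChart_zero hυ θ hθi hθj
  have hIc : (redSubι F₂ (closure (υ ⁻¹' (Set.range (hypersurfaceι (form k)).left \ {vertex 2 k}))) isClosed_closure).ker.comap
      (Spec.map (CommRingCat.ofHom (θ.symm.toRingEquiv : PointBlowup.Chart 2 k 0 →+* MvPolynomial (Fin 3) k)) ≫ vertexChart hυ 0) =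
      affineBlowup.idealSheaf (Ideal.span {f₁ k}) := by
    rw [ker_subschemeι]; exact hSt
  haveI hiso : IsIso (Spec.map (CommRingCat.ofHom (θ.symm.toRingEquiv : PointBlowup.Chart 2 k 0 →+* MvPolynomial (Fin 3) k))) := by
    change IsIso (Spec.map θ.symm.toRingEquiv.toCommRingCatIso.hom); infer_instance
  haveI : IsOpenImmersion (Spec.map (CommRingCat.ofHom (θ.symm.toRingEquiv : PointBlowup.Chart 2 k 0 →+* MvPolynomial (Fin 3) k)) ≫ vertexChart hυ 0) :=
    inferInstance
  obtain ⟨c', hc', hcomm, hcov⟩ := exists_openImmersion_specQuotient (redSubι F₂ _ isClosed_closure) _ (Ideal.span {f₁ k}) hIc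
  refine ⟨c', hc', hcomm, fun z hz => hcov z ?_, ?_, fun j => ?_⟩
  · -- a point over `range (vertexChart υ 0)` is over the range of the polynomial chart (the iso `Spec θ⁻¹` is onto)
    obtain ⟨y, hy⟩ := hz
    obtain ⟨y', hy'⟩ := (Scheme.homeoOfIso (asIso (Spec.map (CommRingCat.ofHom
      (θ.symm.toRingEquiv : PointBlowup.Chart 2 k 0 →+* MvPolynomial (Fin 3) k))))).surjective y
    refine ⟨y', ?_⟩
    rw [Scheme.Hom.comp_apply]
    have : (Spec.map (CommRingCat.ofHom (θ.symm.toRingEquiv : PointBlowup.Chart 2 k 0 →+* MvPolynomial (Fin 3) k))) y' = y := hy'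
    rw [this, hy]
  · rw [comap_comap_of_chart _ _ _ c' hcomm _ _ hZ', span_range_mk_X_cenVars]
  · obtain ⟨j, hj⟩ := j
    have hj' : j = 1 ∨ j = 2 := by
      have : j ≠ 0 := hj
      fin_cases j <;> simp_all
    rw [span_range_mk_X_cenVars]
    rcases hj' with rfl | rfl
    · exact isRegularRing_chart₁ k
    · exact isRegularRing_chart₂ k

end Packet

end Steiner

end Summit.ResolutionOfSingularities.ResolutionOfSingularities.Cruxes.EquisingularLiftNat.Sections

end
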